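import Summits.CriticalPhenomena.PercolationContinuityZ3.Theorems.PercNearOneGluingNoHeavyLowerTailSunflowerTwoLevelPendant
import Summits.CriticalPhenomena.PercolationContinuityZ3.Theorems.PercNearOneGluingNoHeavyLowerTailSunflowerEdgeDecomposition
import Summits.CriticalPhenomena.PercolationContinuityZ3.Theorems.PercNearOneGluingNoHeavyLowerTailSunflowerSafeClosure
import Literature.Probability.LatticeModels.KahnPositiveAssociation
import HarnessLib

/-!
# `NoHeavyLowerTail` (crux stmt-CriticalPhenomena-4575), abstract sunflower cubic: AN EDGE BETWEEN TWO NEW VERTICES HUNG AT TWO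
# LEAVES PRESERVES A-SAFETY — CONDITIONALLY ON THE TWO ANALYTIC INEQUALITIES `GradedTBern` AND `EdgeLemma`

Support file (seat `prim-ineq-prove-1` gen 68; `--supports stmt-CriticalPhenomena-4575`).  No `sorry`; the two conjecture-shaped
inequalities `GradedTBern` (`…SunflowerTwoLevelPendant`) and `EdgeLemma` (`…SunflowerEdgeDecomposition`) enter as hypotheses.
Memo: run/shared/lean/prim/prim-ineq-prove-1/FINDING-EDGE-prove1-g68.md §5.

**`aSafe_edgeCore_close_leaves`**.  Let `Γ₀` be a graph in which `a, b` are isolated, `c` is a leaf hung at `c'`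
(`Γ₀ = Γ_L ⊔ {c'c}`, `c` isolated in `Γ_L`) and `d` is a leaf hung at `d'` (`Γ₀ = Γ_R ⊔ {d'd}`), with `edgeCore Γ₀`, `edgeCore Γ_L`,
`edgeCore Γ_R` A-safe and `Γ_L` (resp. `Γ_R`) having an edge avoiding `c'` (resp. `d'`).  IF `GradedTBern` and `EdgeLemma` hold on their
natural parameter ranges, then the core of `Γ := Γ₀ ⊔ {ab} ⊔ {ac} ⊔ {bd}` — `Γ₀` with the path `c – a – b – d` closing it up — is A-safe.
For `Γ₀` = a path from `c` to `d` on `≥ 4` vertices, `Γ` is the cycle through it: so EVERY CYCLE `C_n`, `n ≥ 6`, HAS AN A-SAFE CORE,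
conditionally on the two inequalities (the cycles `C₅`, `C₇` and the even ones are in the tree unconditionally).
Proof: interior `p` by `safe_of_forall_interior`; `safe_of_edgeLemma` with its seven inputs discharged by the pendant theorem
(`aSafe_edgeCore_add_pendant`), the one-coin lemma (`safe_union_open`), the minors of A-safe cores, positivity of nonempty events at
interior `p` (`Kahn2022.real_pos_of_nonempty`), and the two-level Lemma A at the leaves `c`, `d` (`twoLevel_union_pendant_aSafe`).
-/

noncomputable section

namespace Summit.CriticalPhenomena.PercolationContinuityZ3.Theorems.SunflowerPartition

namespace SafeCalc

open MeasureTheory Finset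
open Literature.Probability.LatticeModels Literature.Probability.Percolation

namespace EdgeDecomp

open UnionEdge Pendant LinkedCurrency

variable {ι : Type*} [DecidableEq ι] [Fintype ι]

omit [DecidableEq ι] [Fintype ι] in
/-- The deletion minor at `v` of a graph core is nonempty as soon as the graph has an edge avoiding `v`. [this work] -/
theorem delMinor_edgeCore_nonempty (Γ : SimpleGraph ι) {v x y : ι} (hxy : Γ.Adj x y) (hx : x ≠ v) (hy : y ≠ v) :
    (delMinor v (edgeCore Γ)).Nonempty := by
  refine ⟨Set.univ, ?_⟩
  change Set.univ \ {v} ∈ edgeCore Γ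
  exact ⟨x, y, hxy, ⟨Set.mem_univ _, hx⟩, ⟨Set.mem_univ _, hy⟩⟩

omit [DecidableEq ι] [Fintype ι] in
/-- A graph core is nonempty as soon as the graph has an edge. [this work] -/
theorem edgeCore_nonempty (Γ : SimpleGraph ι) {x y : ι} (hxy : Γ.Adj x y) : (edgeCore Γ).Nonempty :=
  ⟨Set.univ, x, y, hxy, Set.mem_univ _, Set.mem_univ _⟩

set_option maxHeartbeats 400000 in
/-- **Closing two leaves by a path of two new vertices preserves A-safety, conditionally on `GradedTBern` and `EdgeLemma`.**
See the module docstring.  (For `Γ₀` a path from `c` to `d`, `Γ₀ ⊔ {ab} ⊔ {ac} ⊔ {bd}` is a cycle.) [this work] -/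
theorem aSafe_edgeCore_close_leaves {a b c d c' d' : ι} (hab : a ≠ b) (hca : c ≠ a) (hcb : c ≠ b) (hda : d ≠ a) (hdb : d ≠ b)
    (hcc : c' ≠ c) (hdd : d' ≠ d) (Γ₀ ΓL ΓR : SimpleGraph ι)
    (hL : Γ₀ = ΓL ⊔ SimpleGraph.fromEdgeSet {s(c', c)}) (hLc : ∀ w, ¬ ΓL.Adj c w)
    (hR : Γ₀ = ΓR ⊔ SimpleGraph.fromEdgeSet {s(d', d)}) (hRd : ∀ w, ¬ ΓR.Adj d w)
    (h0a : ∀ w, ¬ Γ₀.Adj a w) (h0b : ∀ w, ¬ Γ₀.Adj b w)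
    (hs0 : ∀ q : ι → unitInterval, Safe q (edgeCore Γ₀)) (hsL : ∀ q : ι → unitInterval, Safe q (edgeCore ΓL))
    (hsR : ∀ q : ι → unitInterval, Safe q (edgeCore ΓR))
    (hneL : ∃ x y, ΓL.Adj x y ∧ x ≠ c' ∧ y ≠ c') (hneR : ∃ x y, ΓR.Adj x y ∧ x ≠ d' ∧ y ≠ d')
    (hG : ∀ s b β : ℝ, 0 < b → b ≤ β → β ≤ 1 → 0 ≤ s → s ≤ 1 → GradedTBern s b β)
    (hE : ∀ p r g₀ gL gR : ℝ, 0 ≤ p → p ≤ 1 → 0 ≤ r → r ≤ 1 → 0 < g₀ → g₀ ≤ gL → gL ≤ 1 → g₀ ≤ gR → gR ≤ 1 →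
      EdgeLemma p r g₀ gL gR)
    (p : ι → unitInterval) :
    Safe p (edgeCore (Γ₀ ⊔ SimpleGraph.fromEdgeSet {s(a, b)} ⊔ SimpleGraph.fromEdgeSet {s(a, c)} ⊔
      SimpleGraph.fromEdgeSet {s(b, d)})) := by
  classical
  rw [edgeCore_sup_edge _ hdb.symm, edgeCore_sup_edge _ hca.symm, edgeCore_sup_edge _ hab]
  refine safe_of_forall_interior (fun q hq => ?_) p
  set A₀ : Set (Set ι) := edgeCore Γ₀ with hA₀
  have hu : IsUpperSet A₀ := isUpperSet_edgeCore Γ₀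
  have hd : DeterminedBy A₀ (↑({a, b} : Finset ι) : Set ι)ᶜ := determinedBy_edgeCore_of_isolated Γ₀ h0a h0b
  -- edges of `ΓL`, `ΓR` are edges of `Γ₀`
  have hL0 : ∀ x y, ΓL.Adj x y → Γ₀.Adj x y := fun x y h => by rw [hL, SimpleGraph.sup_adj]; exact Or.inl h
  have hR0 : ∀ x y, ΓR.Adj x y → Γ₀.Adj x y := fun x y h => by rw [hR, SimpleGraph.sup_adj]; exact Or.inl h
  obtain ⟨xL, yL, hxyL, hxL, hyL⟩ := hneL
  obtain ⟨xR, yR, hxyR, hxR, hyR⟩ := hneR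
  have hxLc : xL ≠ c := fun h => hLc yL (h ▸ hxyL)
  have hyLc : yL ≠ c := fun h => hLc xL (h ▸ hxyL.symm)
  have hxRd : xR ≠ d := fun h => hRd yR (h ▸ hxyR)
  have hyRd : yR ≠ d := fun h => hRd xR (h ▸ hxyR.symm)
  -- positivity at the interior point `q`
  have hpos0 : 0 < (prodBernoulli q).real A₀ := Kahn2022.real_pos_of_nonempty q hq (edgeCore_nonempty Γ₀ (hL0 _ _ hxyL))
  have hposc : 0 < (prodBernoulli q).real (delMinor c A₀) :=
    Kahn2022.real_pos_of_nonempty q hq (delMinor_edgeCore_nonempty Γ₀ (hL0 _ _ hxyL) hxLc hyLc)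
  have hposd : 0 < (prodBernoulli q).real (delMinor d A₀) :=
    Kahn2022.real_pos_of_nonempty q hq (delMinor_edgeCore_nonempty Γ₀ (hR0 _ _ hxyR) hxRd hyRd)
  have hposL : 0 < (prodBernoulli q).real (delMinor c' (edgeCore ΓL)) :=
    Kahn2022.real_pos_of_nonempty q hq (delMinor_edgeCore_nonempty ΓL hxyL hxL hyL)
  have hposR : 0 < (prodBernoulli q).real (delMinor d' (edgeCore ΓR)) :=
    Kahn2022.real_pos_of_nonempty q hq (delMinor_edgeCore_nonempty ΓR hxyR hxR hyR)
  -- the seven safety / two-level inputs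
  have hcup : IsUpperSet {ω : Set ι | c ∈ ω} := fun _ _ hle h => hle h
  have hSL : Safe q (A₀ ∪ {ω | c ∈ ω}) := safe_union_open q c hu (aSafe_delMinor hu hs0 c q) hposc
  have hSR : Safe q (A₀ ∪ {ω | d ∈ ω}) := safe_union_open q d hu (aSafe_delMinor hu hs0 d q) hposd
  have hSX : Safe q (A₀ ∪ pairOpen a c) := by
    have h := aSafe_edgeCore_add_pendant Γ₀ hca h0a hs0 q
    rwa [edgeCore_sup_edge Γ₀ hca, RelLemmaA.pairOpen_comm c a] at h
  have hSY : Safe q (A₀ ∪ pairOpen b d) := by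
    have h := aSafe_edgeCore_add_pendant Γ₀ hdb h0b hs0 q
    rwa [edgeCore_sup_edge Γ₀ hdb, RelLemmaA.pairOpen_comm d b] at h
  have hAL : A₀ = edgeCore ΓL ∪ pairOpen c' c := by rw [hA₀, hL, edgeCore_sup_edge ΓL hcc]
  have hAR : A₀ = edgeCore ΓR ∪ pairOpen d' d := by rw [hA₀, hR, edgeCore_sup_edge ΓR hdd]
  have hTL : TwoLevelLemmaA q A₀ (A₀ ∪ {ω | c ∈ ω}) := by
    have huL : IsUpperSet (edgeCore ΓL) := isUpperSet_edgeCore ΓL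
    have hb0 := hposL
    have hbβ : (prodBernoulli q).real (delMinor c' (edgeCore ΓL)) ≤ (prodBernoulli q).real (conMinor c' (edgeCore ΓL)) :=
      measureReal_mono ((delMinor_subset c' huL).trans (subset_conMinor c' huL))
    have key := twoLevel_union_pendant_aSafe q hcc (determinedBy_edgeCore_of_isolated_one ΓL hLc) huL hsL hposL
      (hG _ _ _ hb0 hbβ measureReal_le_one (q c').2.1 (q c').2.2)
    rw [hAL]; exact key
  have hTR : TwoLevelLemmaA q A₀ (A₀ ∪ {ω | d ∈ ω}) := by
    have huR : IsUpperSet (edgeCore ΓR) := isUpperSet_edgeCore ΓR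
    have hbβ : (prodBernoulli q).real (delMinor d' (edgeCore ΓR)) ≤ (prodBernoulli q).real (conMinor d' (edgeCore ΓR)) :=
      measureReal_mono ((delMinor_subset d' huR).trans (subset_conMinor d' huR))
    have key := twoLevel_union_pendant_aSafe q hdd (determinedBy_edgeCore_of_isolated_one ΓR hRd) huR hsR hposR
      (hG _ _ _ hposR hbβ measureReal_le_one (q d').2.1 (q d').2.2)
    rw [hAR]; exact key
  have hgL : (prodBernoulli q).real A₀ ≤ (prodBernoulli q).real (A₀ ∪ {ω | c ∈ ω}) := measureReal_mono Set.subset_union_left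
  have hgR : (prodBernoulli q).real A₀ ≤ (prodBernoulli q).real (A₀ ∪ {ω | d ∈ ω}) := measureReal_mono Set.subset_union_left
  have hE' := hE (q a : ℝ) (q b : ℝ) _ _ _ (q a).2.1 (q a).2.2 (q b).2.1 (q b).2.2 hpos0 hgL measureReal_le_one hgR
    measureReal_le_one
  exact safe_of_edgeLemma q hab hca hcb hda hdb hd hu (hs0 q) hSL hSR hSX hSY hTL hTR hE'

end EdgeDecomp

end SafeCalc

end Summit.CriticalPhenomena.PercolationContinuityZ3.Theorems.SunflowerPartition
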